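import Mathlib.Combinatorics.SimpleGraph.Paths
import Mathlib.Combinatorics.SimpleGraph.Walk.Maps
import HarnessLib

/-!
# Crux `BoundaryTP2` (stmt-CriticalPhenomena-7115), line `Sketch`: gluing map of the width-4 pair recursion

Helper for the tool stub `stub_strip4_recPair201` (W4-C3: recursion of the disjoint-pair kernel of the
width-4 strip with main path to `(L+1,ρ₂)` and loop `(L+1,ρ₀) → (L+1,ρ₁)`). Abstract setting: graphs
`G₀ ≤ G` on one vertex type; a *last column* `m0 m1 t m3` of fresh vertices of `G` with
`N(t) ⊆ {ps, m1, m3}`, `N(m3) ⊆ {p3, t}`, `N(m0) ⊆ {p0, m1}`, `N(m1) ⊆ {p1, m0, t}`; the edges of `G`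
between old vertices are edges of `G₀`, whose edges end at old vertices. For a vertex-disjoint pair of
self-avoiding paths `(γ : a → t, γ' : m0 → m1)` of `G`, the loop `γ'` is the rung `m0 m1` or the dip
`m0 p0 · δ · p1 m1` with `δ` a path of `G₀` (its last step cannot come from `t ∈ γ`; `m3` would be a
dead end, `s4p201_deadEnd`), and `γ` is `γ₀ · ps t` or `γ₀ · p3 m3 t` with `γ₀` a path of `G₀`
(`s4p201_exists_glueL`, by peeling the last edges, `s4p201_peel`). **Main result**
`s4p201_exists_glue`: these gluings form an injection
`(A ⊕ B) ⊕ ((A ⊕ B) × D) → Path_G(a,t) × Path_G(m0,m1)` (`A, B, D` the path types `a → ps`, `a → p3`,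
`p0 → p1` of `G₀`) whose range contains every disjoint pair, with explicit disjointness relations and
lengths. Mathlib only. [folklore]
-/

noncomputable section

namespace Summit.CriticalPhenomena.SAWScalingLimit.Theorems.BoundaryTP2

open SimpleGraph Walk

variable {V : Type*}

/-- If every edge of `G` ends in `P`, a walk of `G` that starts in `P` stays in `P`. [folklore] -/
private theorem s4p201_forall_mem_support {G : SimpleGraph V} {P : V → Prop}
    (hG : ∀ u v, G.Adj u v → P v) {u v : V} (p : G.Walk u v) (hu : P u) : ∀ z ∈ p.support, P z := by
  induction p with
  | nil => intro z hz; rw [support_nil, List.mem_singleton] at hz; exact hz ▸ hu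
  | cons h q ih =>
    intro z hz
    rw [support_cons, List.mem_cons] at hz
    rcases hz with rfl | hz
    exacts [hu, ih (hG _ _ h) z hz]

/-- The edges of a walk of `H` whose vertices satisfy `P` lie in any graph `G` containing the
`P`-internal edges of `H`. [folklore] -/
private theorem s4p201_edges_mem_of_support {H G : SimpleGraph V} {P : V → Prop}
    (hG : ∀ u v, H.Adj u v → P u → P v → G.Adj u v) {u v : V} (p : H.Walk u v)
    (hp : ∀ z ∈ p.support, P z) : ∀ e, e ∈ p.edges → e ∈ G.edgeSet := by
  induction p with
  | nil => intro e he; simp at he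
  | cons h q ih =>
    intro e he
    rw [edges_cons, List.mem_cons] at he
    rcases he with rfl | he
    · exact (mem_edgeSet G).2 (hG _ _ h (hp _ (by simp)) (hp _ (by simp)))
    · exact ih (fun z hz => hp z (by simp [hz])) e he

/-- The edges of a walk of a subgraph `G ≤ H` are edges of `H`. [folklore] -/
private theorem s4p201_edges_mem_of_le {G H : SimpleGraph V} (hle : G ≤ H) {u v : V} (p : G.Walk u v) :
    ∀ e, e ∈ p.edges → e ∈ H.edgeSet :=
  fun _ he => edgeSet_mono hle (p.edges_subset_edgeSet he)

/-- **Peeling the last edge.** A path `p : u → w` (`u ≠ w`) of `H` whose last step can only come from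
`e` and whose vertices `≠ w` satisfy `P` is `p₀ · (e w)` for a path `p₀ : u → e` of any `G ≤ H`
containing the `P`-internal edges of `H`. [folklore] -/
private theorem s4p201_peel {H G : SimpleGraph V} {P : V → Prop} (hle : G ≤ H)
    (hG : ∀ u v, H.Adj u v → P u → P v → G.Adj u v) {u w e : V} (p : H.Walk u w) (hp : p.IsPath)
    (hne : u ≠ w) (hlast : ∀ v, H.Adj w v → v ∈ p.support → v = e)
    (hP : ∀ z ∈ p.support, z ≠ w → P z) :
    ∃ (p₀ : G.Walk u e) (h : H.Adj e w), p₀.IsPath ∧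
      p = (p₀.transfer H (s4p201_edges_mem_of_le hle p₀)).concat h := by
  obtain ⟨v, h, q, hq⟩ := exists_eq_cons_of_ne hne.symm p.reverse
  have hsub : ∀ z ∈ q.support, z ∈ p.support := fun z hz => by
    rw [← List.mem_reverse, ← support_reverse, hq, support_cons]
    exact List.mem_cons_of_mem _ hz
  obtain rfl : v = e := hlast v h (hsub v q.start_mem_support)
  have hrev := hp.reverse
  rw [hq, cons_isPath_iff] at hrev
  have hPq : ∀ z ∈ q.reverse.support, P z := fun z hz => by
    rw [support_reverse, List.mem_reverse] at hz
    exact hP z (hsub z hz) fun hzw => hrev.2 (hzw ▸ hz)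
  refine ⟨q.reverse.transfer G (s4p201_edges_mem_of_support hG _ hPq), h.symm,
    hrev.1.reverse.transfer _, ?_⟩
  conv_lhs => rw [← reverse_reverse p, hq, reverse_cons]
  rw [transfer_transfer, transfer_self]
  rfl

/-- **Dead ends.** A vertex `c` off the ends of a path, all of whose neighbours other than `d` are off
the path, is off the path. [folklore] -/
private theorem s4p201_deadEnd {G : SimpleGraph V} {c d e : V} (hN : ∀ y, G.Adj c y → y = d ∨ y = e)
    {u v : V} (p : G.Walk u v) (hp : p.IsPath) (he : e ∉ p.support) (hcu : c ≠ u) (hcv : c ≠ v) :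
    c ∉ p.support := by
  induction p with
  | nil => rwa [support_nil, List.mem_singleton]
  | @cons u w v h q ih =>
    rw [cons_isPath_iff] at hp
    rw [support_cons, List.mem_cons, not_or] at he ⊢
    refine ⟨hcu, fun hcq => ?_⟩
    by_cases hcw : c = w
    · subst hcw
      obtain ⟨y, h', q', rfl⟩ := exists_eq_cons_of_ne hcv q
      rw [support_cons, List.mem_cons, not_or] at he
      have hu : u = d := (hN u h.symm).resolve_right fun hue => he.1 hue.symm
      rcases hN y h' with rfl | rfl
      · exact hp.2 (by rw [support_cons, hu]; exact List.mem_cons_of_mem _ q'.start_mem_support)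
      · exact he.2.2 q'.start_mem_support
    · exact ih hp.1 he.2 hcw hcv hcq

/-- The gluing `γ₀ ↦ γ₀ · (ps t)` (after transfer to the big graph) is injective. [folklore] -/
private theorem s4p201_glue1_inj {G₀ G : SimpleGraph V} (hle : G₀ ≤ G) {a ps t : V} (hpt : G.Adj ps t)
    {γ γ' : G₀.Walk a ps} (h : (γ.transfer G (s4p201_edges_mem_of_le hle γ)).concat hpt =
      (γ'.transfer G (s4p201_edges_mem_of_le hle γ')).concat hpt) : γ = γ' := by
  have h' := congrArg edges h
  simp only [edges_concat, edges_transfer, List.concat_eq_append] at h'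
  exact edges_injective (List.append_cancel_right h')

/-- The gluing `γ₀ ↦ γ₀ · (p3 m3) · (m3 t)` (after transfer to the big graph) is injective. [folklore] -/
private theorem s4p201_glue2_inj {G₀ G : SimpleGraph V} (hle : G₀ ≤ G) {a p3 m3 t : V}
    (hp3m3 : G.Adj p3 m3) (hm3t : G.Adj m3 t) {γ γ' : G₀.Walk a p3}
    (h : ((γ.transfer G (s4p201_edges_mem_of_le hle γ)).concat hp3m3).concat hm3t =
      ((γ'.transfer G (s4p201_edges_mem_of_le hle γ')).concat hp3m3).concat hm3t) : γ = γ' := by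
  have h' := congrArg edges h
  simp only [edges_concat, edges_transfer, List.concat_eq_append] at h'
  exact edges_injective (List.append_cancel_right (List.append_cancel_right h'))

/-- The gluing `δ ↦ (m0 p0) · δ · (p1 m1)` (after transfer to the big graph) is injective. [folklore] -/
private theorem s4p201_glueR_inj {G₀ G : SimpleGraph V} (hle : G₀ ≤ G) {p0 p1 m0 m1 : V}
    (hm0p0 : G.Adj m0 p0) (hp1m1 : G.Adj p1 m1) {δ δ' : G₀.Walk p0 p1}
    (h : cons hm0p0 ((δ.transfer G (s4p201_edges_mem_of_le hle δ)).concat hp1m1) =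
      cons hm0p0 ((δ'.transfer G (s4p201_edges_mem_of_le hle δ')).concat hp1m1)) : δ = δ' := by
  have h' := congrArg edges h
  simp only [edges_cons, edges_concat, edges_transfer, List.concat_eq_append, List.cons.injEq,
    true_and] at h'
  exact edges_injective (List.append_cancel_right h')

/-- **Gluing the main path** (abstract last column `m0 m1 t m3` of `G ≥ G₀`, `N(t) ⊆ {ps, m1, m3}`,
`N(m3) ⊆ {p3, t}`). `γ₀ ↦ γ₀ · (ps t)` and `γ₀ ↦ γ₀ · (p3 m3 t)` form an injection
`Path_{G₀}(a,ps) ⊕ Path_{G₀}(a,p3) → Path_G(a,t)` whose range contains every path avoiding `m0, m1`,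
with the stated supports and lengths. [folklore] -/
private theorem s4p201_exists_glueL {G₀ G : SimpleGraph V} {a ps p3 t m0 m1 m3 : V} (hle : G₀ ≤ G)
    (hold : ∀ u v, G.Adj u v → (u ≠ t ∧ u ≠ m0 ∧ u ≠ m1 ∧ u ≠ m3) →
      (v ≠ t ∧ v ≠ m0 ∧ v ≠ m1 ∧ v ≠ m3) → G₀.Adj u v)
    (hG₀ : ∀ u v, G₀.Adj u v → v ≠ t ∧ v ≠ m0 ∧ v ≠ m1 ∧ v ≠ m3)
    (ha : a ≠ t ∧ a ≠ m0 ∧ a ≠ m1 ∧ a ≠ m3) (hps : ps ≠ m3)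
    (hpt : G.Adj ps t) (hp3m3 : G.Adj p3 m3) (hm3t : G.Adj m3 t)
    (hNt : ∀ u, G.Adj t u → u = ps ∨ u = m1 ∨ u = m3) (hNm3 : ∀ u, G.Adj m3 u → u = p3 ∨ u = t) :
    ∃ g : G₀.Path a ps ⊕ G₀.Path a p3 → G.Path a t,
      Function.Injective g ∧
      (∀ γ : G.Path a t, m0 ∉ γ.1.support → m1 ∉ γ.1.support → γ ∈ Set.range g) ∧
      (∀ γ₀, (g (Sum.inl γ₀)).1.support = γ₀.1.support ++ [t] ∧
        (g (Sum.inl γ₀)).1.length = γ₀.1.length + 1) ∧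
      (∀ γ₀, (g (Sum.inr γ₀)).1.support = γ₀.1.support ++ [m3, t] ∧
        (g (Sum.inr γ₀)).1.length = γ₀.1.length + 2) := by
  have hPa : ∀ {u : V} (w : G₀.Walk a u) (z : V), z ∈ w.support →
      z ≠ t ∧ z ≠ m0 ∧ z ≠ m1 ∧ z ≠ m3 :=
    fun w => s4p201_forall_mem_support (P := fun z => z ≠ t ∧ z ≠ m0 ∧ z ≠ m1 ∧ z ≠ m3) hG₀ w ha
  have htm3 : t ≠ m3 := hm3t.ne.symm
  -- the glued walks are self-avoiding
  have hL2 : ∀ γ₀ : G₀.Path a ps,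
      ((γ₀.1.transfer G (s4p201_edges_mem_of_le hle γ₀.1)).concat hpt).IsPath := fun γ₀ =>
    (γ₀.2.transfer _).concat (by rw [support_transfer]; exact fun h => (hPa γ₀.1 t h).1 rfl) hpt
  have hL3 : ∀ γ₀ : G₀.Path a p3,
      (((γ₀.1.transfer G (s4p201_edges_mem_of_le hle γ₀.1)).concat hp3m3).concat hm3t).IsPath := by
    intro γ₀
    refine ((γ₀.2.transfer _).concat ?_ hp3m3).concat ?_ hm3t
    · rw [support_transfer]; exact fun h => (hPa γ₀.1 m3 h).2.2.2 rfl
    · rw [support_concat, support_transfer, List.mem_append, List.mem_singleton, not_or]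
      exact ⟨fun h => (hPa γ₀.1 t h).1 rfl, htm3⟩
  refine ⟨Sum.elim (fun γ₀ => ⟨_, hL2 γ₀⟩) (fun γ₀ => ⟨_, hL3 γ₀⟩), ?_, ?_, ?_, ?_⟩
  · -- injectivity: the two classes are told apart by `m3`
    have key : ∀ (γ₀ : G₀.Path a ps) (γ₀' : G₀.Path a p3),
        (⟨_, hL2 γ₀⟩ : G.Path a t) ≠ ⟨_, hL3 γ₀'⟩ := fun γ₀ γ₀' h => by
      have hw : (γ₀.1.transfer G (s4p201_edges_mem_of_le hle γ₀.1)).concat hpt =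
          ((γ₀'.1.transfer G (s4p201_edges_mem_of_le hle γ₀'.1)).concat hp3m3).concat hm3t :=
        congrArg Subtype.val h
      have h' : m3 ∈ ((γ₀.1.transfer G (s4p201_edges_mem_of_le hle γ₀.1)).concat hpt).support := by
        rw [hw, support_concat, support_concat]; simp
      rw [support_concat, support_transfer, List.mem_append, List.mem_singleton] at h'
      exact h'.elim (fun h => (hPa γ₀.1 m3 h).2.2.2 rfl) htm3.symm
    rintro (γ₀ | γ₀) (γ₀' | γ₀') h
    · exact congrArg Sum.inl (Subtype.ext (s4p201_glue1_inj hle hpt (congrArg (fun q => q.1) h)))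
    · exact absurd h (key γ₀ γ₀')
    · exact absurd h.symm (key γ₀' γ₀)
    · exact congrArg Sum.inr (Subtype.ext (s4p201_glue2_inj hle hp3m3 hm3t
        (congrArg (fun q => q.1) h)))
  · -- the range contains the paths avoiding `m0, m1`
    rintro γ hm0 hm1
    obtain ⟨v, h, q, hq⟩ := exists_eq_cons_of_ne (Ne.symm ha.1) γ.1.reverse
    have hrev := γ.2.reverse
    rw [hq, cons_isPath_iff] at hrev
    obtain ⟨hq1, htq⟩ := hrev
    have hsub : ∀ z ∈ q.support, z ∈ γ.1.support := fun z hz => by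
      rw [← List.mem_reverse, ← support_reverse, hq, support_cons]
      exact List.mem_cons_of_mem _ hz
    obtain hv | hv | hv := hNt v h <;> subst v
    · -- `γ` enters `t` from `ps`
      have hm3 : m3 ∉ q.support := s4p201_deadEnd hNm3 q hq1 htq hps.symm ha.2.2.2.symm
      have hPq : ∀ z ∈ q.reverse.support, z ≠ t ∧ z ≠ m0 ∧ z ≠ m1 ∧ z ≠ m3 := fun z hz => by
        rw [support_reverse, List.mem_reverse] at hz
        have hz' := hsub z hz
        exact ⟨fun e => htq (by rw [e] at hz; exact hz), fun e => hm0 (by rw [e] at hz'; exact hz'),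
          fun e => hm1 (by rw [e] at hz'; exact hz'), fun e => hm3 (by rw [e] at hz; exact hz)⟩
      refine ⟨Sum.inl ⟨q.reverse.transfer G₀ (s4p201_edges_mem_of_support hold _ hPq),
        hq1.reverse.transfer _⟩, Subtype.ext ?_⟩
      simp only [Sum.elim_inl]
      rw [transfer_transfer, transfer_self, ← reverse_reverse γ.1, hq, reverse_cons]
      rfl
    · exact absurd (hsub _ q.start_mem_support) hm1
    · -- `γ` enters `t` along `p3 m3 t`
      obtain ⟨v', h', q', rfl⟩ := exists_eq_cons_of_ne ha.2.2.2.symm q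
      rw [cons_isPath_iff] at hq1
      rw [support_cons, List.mem_cons, not_or] at htq
      obtain hv' | hv' := hNm3 v' h' <;> subst v'
      · have hPq : ∀ z ∈ q'.reverse.support, z ≠ t ∧ z ≠ m0 ∧ z ≠ m1 ∧ z ≠ m3 := fun z hz => by
          rw [support_reverse, List.mem_reverse] at hz
          have hz' : z ∈ γ.1.support :=
            hsub z (by rw [support_cons]; exact List.mem_cons_of_mem _ hz)
          exact ⟨fun e => htq.2 (by rw [e] at hz; exact hz),
            fun e => hm0 (by rw [e] at hz'; exact hz'), fun e => hm1 (by rw [e] at hz'; exact hz'),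
            fun e => hq1.2 (by rw [e] at hz; exact hz)⟩
        refine ⟨Sum.inr ⟨q'.reverse.transfer G₀ (s4p201_edges_mem_of_support hold _ hPq),
          hq1.1.reverse.transfer _⟩, Subtype.ext ?_⟩
        simp only [Sum.elim_inr]
        rw [transfer_transfer, transfer_self, ← reverse_reverse γ.1, hq, reverse_cons, reverse_cons]
        rfl
      · exact absurd q'.start_mem_support htq.2
  · intro γ₀
    simp only [Sum.elim_inl, support_concat, support_transfer, length_concat, length_transfer,
      and_self]
  · intro γ₀
    simp only [Sum.elim_inr, support_concat, support_transfer, length_concat, length_transfer,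
      List.append_assoc, List.singleton_append, and_self]

/-- Disjointness bookkeeping for the glued pairs: `l₀, l₁` old, `l ⊆ {t, m3}`. [folklore] -/
private theorem s4p201_disjoint_iff {t m0 m1 m3 : V} (ht0 : t ≠ m0) (ht1 : t ≠ m1) (h03 : m0 ≠ m3)
    (h13 : m1 ≠ m3) {l₀ l l₁ : List V} (hl₀ : ∀ z ∈ l₀, z ≠ t ∧ z ≠ m0 ∧ z ≠ m1 ∧ z ≠ m3)
    (hl : ∀ z ∈ l, z = t ∨ z = m3) (hl₁ : ∀ z ∈ l₁, z ≠ t ∧ z ≠ m0 ∧ z ≠ m1 ∧ z ≠ m3) :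
    List.Disjoint (l₀ ++ l) [m0, m1] ∧
      (List.Disjoint (l₀ ++ l) (m0 :: (l₁ ++ [m1])) ↔ List.Disjoint l₀ l₁) := by
  have hnew : ∀ z ∈ l, z ≠ m0 ∧ z ≠ m1 := fun z hz => by
    rcases hl z hz with rfl | rfl
    exacts [⟨ht0, ht1⟩, ⟨h03.symm, h13.symm⟩]
  refine ⟨fun z hz hz' => ?_, fun h z hz hz' => h (List.mem_append_left _ hz)
    (List.mem_cons_of_mem _ (List.mem_append_left _ hz')), fun h z hz hz' => ?_⟩
  · rw [List.mem_cons, List.mem_singleton] at hz'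
    rw [List.mem_append] at hz
    rcases hz with hz | hz
    · rcases hz' with rfl | rfl
      exacts [(hl₀ _ hz).2.1 rfl, (hl₀ _ hz).2.2.1 rfl]
    · rcases hz' with rfl | rfl
      exacts [(hnew _ hz).1 rfl, (hnew _ hz).2 rfl]
  · rw [List.mem_cons, List.mem_append, List.mem_singleton] at hz'
    rw [List.mem_append] at hz
    rcases hz with hz | hz
    · rcases hz' with rfl | hz' | rfl
      exacts [(hl₀ _ hz).2.1 rfl, h hz hz', (hl₀ _ hz).2.2.1 rfl]
    · rcases hz' with rfl | hz' | rfl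
      · exact (hnew _ hz).1 rfl
      · rcases hl z hz with e | e
        exacts [(hl₁ _ hz').1 e, (hl₁ _ hz').2.2.2 e]
      · exact (hnew _ hz).2 rfl

/-- **The gluing map** (abstract last column `m0 m1 t m3` of `G ≥ G₀`: `N(t) ⊆ {ps, m1, m3}`,
`N(m3) ⊆ {p3, t}`, `N(m0) ⊆ {p0, m1}`, `N(m1) ⊆ {p1, m0, t}`; the edges of `G` between old vertices are
edges of `G₀`, whose edges end at old vertices). Pairing the main-path gluing `s4p201_exists_glueL` with
the rung `m0 m1` or with the dip `m0 p0 · δ · p1 m1` gives an injection into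
`Path_G(a,t) × Path_G(m0,m1)` whose range contains every vertex-disjoint pair, with the stated
disjointness relations and lengths. [folklore] -/
theorem s4p201_exists_glue {V : Type*} {G₀ G : SimpleGraph V} {a ps p3 p0 p1 t m0 m1 m3 : V} (hle : G₀ ≤ G)
    (hold : ∀ u v, G.Adj u v → (u ≠ t ∧ u ≠ m0 ∧ u ≠ m1 ∧ u ≠ m3) →
      (v ≠ t ∧ v ≠ m0 ∧ v ≠ m1 ∧ v ≠ m3) → G₀.Adj u v)
    (hG₀ : ∀ u v, G₀.Adj u v → v ≠ t ∧ v ≠ m0 ∧ v ≠ m1 ∧ v ≠ m3)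
    (ha : a ≠ t ∧ a ≠ m0 ∧ a ≠ m1 ∧ a ≠ m3) (hp0 : p0 ≠ t ∧ p0 ≠ m0 ∧ p0 ≠ m1 ∧ p0 ≠ m3)
    (hps : ps ≠ m3) (hpt : G.Adj ps t) (hp3m3 : G.Adj p3 m3) (hm3t : G.Adj m3 t)
    (hm0m1 : G.Adj m0 m1) (hm0p0 : G.Adj m0 p0) (hp1m1 : G.Adj p1 m1)
    (hNt : ∀ u, G.Adj t u → u = ps ∨ u = m1 ∨ u = m3) (hNm3 : ∀ u, G.Adj m3 u → u = p3 ∨ u = t)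
    (hNm0 : ∀ u, G.Adj m0 u → u = p0 ∨ u = m1) (hNm1 : ∀ u, G.Adj m1 u → u = p1 ∨ u = m0 ∨ u = t)
    (ht0 : t ≠ m0) (ht1 : t ≠ m1) (h03 : m0 ≠ m3) (h13 : m1 ≠ m3) :
    ∃ g : (G₀.Path a ps ⊕ G₀.Path a p3) ⊕ ((G₀.Path a ps ⊕ G₀.Path a p3) × G₀.Path p0 p1) →
        G.Path a t × G.Path m0 m1,
      Function.Injective g ∧
      (∀ q : G.Path a t × G.Path m0 m1, List.Disjoint q.1.1.support q.2.1.support →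
        q ∈ Set.range g) ∧
      (∀ γ₀ : G₀.Path a ps, List.Disjoint (g (Sum.inl (Sum.inl γ₀))).1.1.support
          (g (Sum.inl (Sum.inl γ₀))).2.1.support ∧
        (g (Sum.inl (Sum.inl γ₀))).1.1.length = γ₀.1.length + 1 ∧
        (g (Sum.inl (Sum.inl γ₀))).2.1.length = 1) ∧
      (∀ γ₀ : G₀.Path a p3, List.Disjoint (g (Sum.inl (Sum.inr γ₀))).1.1.support
          (g (Sum.inl (Sum.inr γ₀))).2.1.support ∧
        (g (Sum.inl (Sum.inr γ₀))).1.1.length = γ₀.1.length + 2 ∧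
        (g (Sum.inl (Sum.inr γ₀))).2.1.length = 1) ∧
      (∀ (γ₀ : G₀.Path a ps) (δ : G₀.Path p0 p1),
        (List.Disjoint (g (Sum.inr (Sum.inl γ₀, δ))).1.1.support
            (g (Sum.inr (Sum.inl γ₀, δ))).2.1.support ↔ List.Disjoint γ₀.1.support δ.1.support) ∧
        (g (Sum.inr (Sum.inl γ₀, δ))).1.1.length = γ₀.1.length + 1 ∧
        (g (Sum.inr (Sum.inl γ₀, δ))).2.1.length = δ.1.length + 2) ∧
      (∀ (γ₀ : G₀.Path a p3) (δ : G₀.Path p0 p1),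
        (List.Disjoint (g (Sum.inr (Sum.inr γ₀, δ))).1.1.support
            (g (Sum.inr (Sum.inr γ₀, δ))).2.1.support ↔ List.Disjoint γ₀.1.support δ.1.support) ∧
        (g (Sum.inr (Sum.inr γ₀, δ))).1.1.length = γ₀.1.length + 2 ∧
        (g (Sum.inr (Sum.inr γ₀, δ))).2.1.length = δ.1.length + 2) := by
  obtain ⟨g₁, hinj₁, hrange₁, hinl₁, hinr₁⟩ :=
    s4p201_exists_glueL hle hold hG₀ ha hps hpt hp3m3 hm3t hNt hNm3
  have hPa : ∀ {u : V} (w : G₀.Walk a u) (z : V), z ∈ w.support →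
      z ≠ t ∧ z ≠ m0 ∧ z ≠ m1 ∧ z ≠ m3 :=
    fun w => s4p201_forall_mem_support (P := fun z => z ≠ t ∧ z ≠ m0 ∧ z ≠ m1 ∧ z ≠ m3) hG₀ w ha
  have hPp : ∀ {u : V} (w : G₀.Walk p0 u) (z : V), z ∈ w.support →
      z ≠ t ∧ z ≠ m0 ∧ z ≠ m1 ∧ z ≠ m3 :=
    fun w => s4p201_forall_mem_support (P := fun z => z ≠ t ∧ z ≠ m0 ∧ z ≠ m1 ∧ z ≠ m3) hG₀ w hp0
  have hD := @s4p201_disjoint_iff V t m0 m1 m3 ht0 ht1 h03 h13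
  -- the loops: the rung and the dips
  have hE : (cons hm0m1 (nil : G.Walk m1 m1)).IsPath := by
    rw [cons_isPath_iff, support_nil, List.mem_singleton]
    exact ⟨IsPath.nil, hm0m1.ne⟩
  have hR : ∀ δ : G₀.Path p0 p1,
      (cons hm0p0 ((δ.1.transfer G (s4p201_edges_mem_of_le hle δ.1)).concat hp1m1)).IsPath := by
    intro δ
    rw [cons_isPath_iff, support_concat, support_transfer, List.mem_append, List.mem_singleton,
      not_or]
    exact ⟨(δ.2.transfer _).concat (by rw [support_transfer]; exact fun h => (hPp δ.1 m1 h).2.2.1 rfl)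
      hp1m1, fun h => (hPp δ.1 m0 h).2.1 rfl, hm0m1.ne⟩
  have hRsupp : ∀ δ : G₀.Path p0 p1,
      (cons hm0p0 ((δ.1.transfer G (s4p201_edges_mem_of_le hle δ.1)).concat hp1m1)).support =
        m0 :: (δ.1.support ++ [m1]) := fun δ => by
    rw [support_cons, support_concat, support_transfer]
  have ht : ∀ z ∈ [t], z = t ∨ z = m3 := by simp
  have hmt : ∀ z ∈ [m3, t], z = t ∨ z = m3 := by simp
  refine ⟨Sum.elim (fun s => (g₁ s, ⟨_, hE⟩)) (fun q => (g₁ q.1, ⟨_, hR q.2⟩)), ?_, ?_, ?_, ?_, ?_, ?_⟩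
  · -- injectivity
    rintro (s | ⟨s, δ⟩) (s' | ⟨s', δ'⟩) h
    · exact congrArg Sum.inl (hinj₁ (congrArg Prod.fst h))
    pick_goal 3
    · exact congrArg Sum.inr (Prod.ext (hinj₁ (congrArg Prod.fst h)) (Subtype.ext
        (s4p201_glueR_inj hle hm0p0 hp1m1 (congrArg (fun q => q.2.1) h))))
    all_goals
      have h1 := congrArg (fun q => q.2.1.length) h
      simp only [Sum.elim_inl, Sum.elim_inr, length_cons, length_nil, length_concat,
        length_transfer] at h1
      omega
  · -- the range contains the disjoint pairs
    rintro ⟨γ, γ'⟩ hd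
    have htγ' : t ∉ γ'.1.support := fun h => hd γ.1.end_mem_support h
    have hm0γ : m0 ∉ γ.1.support := fun h => hd h γ'.1.start_mem_support
    have hm1γ : m1 ∉ γ.1.support := fun h => hd h γ'.1.end_mem_support
    obtain ⟨s, hs⟩ := hrange₁ γ hm0γ hm1γ
    -- the first step of `γ'`: to `p0` (a dip through `G₀`) or to `m1` (the rung)
    obtain ⟨v, hmv, q, hq⟩ := exists_eq_cons_of_ne hm0m1.ne γ'.1
    have hq' := γ'.2
    rw [hq, cons_isPath_iff] at hq'
    have hqsub : ∀ z ∈ q.support, z ∈ γ'.1.support := fun z hz => by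
      rw [hq, support_cons]
      exact List.mem_cons_of_mem _ hz
    obtain hv | hv := hNm0 v hmv <;> subst v
    · have htq : t ∉ q.support := fun h => htγ' (hqsub t h)
      have hm3q : m3 ∉ q.support := s4p201_deadEnd hNm3 q hq'.1 htq hp0.2.2.2.symm h13.symm
      obtain ⟨δ, hp1m1', hδ, hqδ⟩ := s4p201_peel (P := fun z => z ≠ t ∧ z ≠ m0 ∧ z ≠ m1 ∧ z ≠ m3)
        hle hold q hq'.1 hp0.2.2.1
        (fun u hu huq => (hNm1 u hu).resolve_right fun h' => h'.elim (fun hum => hq'.2 (hum ▸ huq))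
          fun hut => htq (hut ▸ huq))
        (fun z hz hzm1 => ⟨fun e => htq (e ▸ hz), fun e => hq'.2 (e ▸ hz), hzm1,
          fun e => hm3q (e ▸ hz)⟩)
      refine Set.mem_range.2 ⟨Sum.inr (s, ⟨δ, hδ⟩), ?_⟩
      simp only [Sum.elim_inr]
      refine Prod.ext hs (Subtype.ext ?_)
      change _ = γ'.1
      rw [hq, hqδ]
    · have hqnil : q = nil := eq_nil_iff_nil.2 (isPath_iff_nil.1 hq'.1)
      refine Set.mem_range.2 ⟨Sum.inl s, ?_⟩
      simp only [Sum.elim_inl]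
      refine Prod.ext hs (Subtype.ext ?_)
      change _ = γ'.1
      rw [hq, hqnil]
  · intro γ₀
    obtain ⟨hsupp, hlen⟩ := hinl₁ γ₀
    refine ⟨?_, hlen, rfl⟩
    change List.Disjoint (g₁ (Sum.inl γ₀)).1.support (cons hm0m1 nil).support
    rw [hsupp, support_cons, support_nil]
    exact (hD (hPa γ₀.1) ht (hPp (nil : G₀.Walk p0 p0))).1
  · intro γ₀
    obtain ⟨hsupp, hlen⟩ := hinr₁ γ₀
    refine ⟨?_, hlen, rfl⟩
    change List.Disjoint (g₁ (Sum.inr γ₀)).1.support (cons hm0m1 nil).support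
    rw [hsupp, support_cons, support_nil]
    exact (hD (hPa γ₀.1) hmt (hPp (nil : G₀.Walk p0 p0))).1
  · intro γ₀ δ
    obtain ⟨hsupp, hlen⟩ := hinl₁ γ₀
    refine ⟨?_, hlen, by simp⟩
    change List.Disjoint (g₁ (Sum.inl γ₀)).1.support
      (cons hm0p0 ((δ.1.transfer G (s4p201_edges_mem_of_le hle δ.1)).concat hp1m1)).support ↔ _
    rw [hsupp, hRsupp]
    exact (hD (hPa γ₀.1) ht (hPp δ.1)).2
  · intro γ₀ δ
    obtain ⟨hsupp, hlen⟩ := hinr₁ γ₀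
    refine ⟨?_, hlen, by simp⟩
    change List.Disjoint (g₁ (Sum.inr γ₀)).1.support
      (cons hm0p0 ((δ.1.transfer G (s4p201_edges_mem_of_le hle δ.1)).concat hp1m1)).support ↔ _
    rw [hsupp, hRsupp]
    exact (hD (hPa γ₀.1) hmt (hPp δ.1)).2

end Summit.CriticalPhenomena.SAWScalingLimit.Theorems.BoundaryTP2
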